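import Mathlib
import HarnessLib
import Literature.Analysis.PDE.DivFormLiouville
import Summits.NavierStokesRegularity.NavierStokesRegularity.Theorems.PoloidalWindowDoorPoloidalWindowRigidityDivFormCaccioppoli

/-!
# Route `PoloidalWindowDoor`, crux K2 (stmt-NavierStokesRegularity-19708) — task H5, step M1b: POWER and LOGARITHMIC
# Caccioppoli inequalities for `div(a∇u) = 0` (towards `divFormLiouville_holds`, De Giorgi–Nash–Moser)

Specialisations of `…DivFormCaccioppoli.caccioppoli_weighted` (seat ns-poloidal-K2-p3 g2, `ledger fact claim` #1 on
`Literature.Analysis.PDE.divFormLiouville`; setting = that fact's rendering, `u ≥ 1`):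

* `caccioppoli_rpow` — weight `g(s) = s^β/β`, `β ≠ 0` (Moser 1961 §4, (4.4); Gilbarg–Trudinger (8.52)):
  `∫ χ² u^{β−1} Du·aDu ≤ (4/β²) ∫ u^{β+1} Dχ·aDχ`;
* `caccioppoli_log` — weight `g(s) = −1/s` (the case `β = −1`; Moser 1961 §5, the logarithmic estimate):
  `∫ χ² u^{−2} Du·aDu ≤ 4 ∫ Dχ·aDχ`, i.e. `λ ∫ χ²|∇ log u|² ≤ 4nΛ ∫ |∇χ|²` (`gradLog_estimate`);
(The Sobolev-ready form for `w = u^{p/2}` — `λ ∫ χ² ‖D(u^{p/2})‖² ≤ (p/(p−1))²·nΛ·∫ u^p ‖Dχ‖²` — is derived in the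
Moser-iteration file M3 from `caccioppoli_rpow`.)

WHAT THIS IS NOT: not yet the Liouville theorem (M2–M4 to come); nothing NS-specific.
-/

noncomputable section

open MeasureTheory Set Function Filter Topology Metric
open scoped Matrix

-- the summit and its single sub-problem share the name (CONVENTIONS §1), as in every Theorems file
set_option linter.dupNamespace false

namespace Summit.NavierStokesRegularity.NavierStokesRegularity.Theorems.PoloidalWindowDoorPoloidalWindowRigidityDivFormCaccioppoliPowers

open Summit.NavierStokesRegularity.NavierStokesRegularity.Theorems.PoloidalWindowDoorPoloidalWindowRigidityDivFormCaccioppoli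

variable {n : ℕ} {a : EuclideanSpace ℝ (Fin n) → Matrix (Fin n) (Fin n) ℝ} {lam Λ : ℝ}
  {u : EuclideanSpace ℝ (Fin n) → ℝ}

/-! ### The two weights -/

/-- `s ↦ s^β/β` is `C¹` on `]½,∞[`. -/
theorem contDiffOn_rpow_div (β : ℝ) : ContDiffOn ℝ 1 (fun s : ℝ => s ^ β / β) (Ioi (1 / 2)) := by
  intro s hs
  have hs0 : s ≠ 0 := by simp only [mem_Ioi] at hs; exact (by linarith : (0:ℝ) < s).ne'
  exact ((Real.contDiffAt_rpow_const_of_ne (p := β) (n := 1) hs0).div_const β).contDiffWithinAt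

/-- `(s^β/β)′ = s^{β−1}` for `s ≠ 0`, `β ≠ 0`. -/
theorem deriv_rpow_div {β : ℝ} (hβ : β ≠ 0) {s : ℝ} (hs : s ≠ 0) :
    deriv (fun s : ℝ => s ^ β / β) s = s ^ (β - 1) := by
  have h : HasDerivAt (fun s : ℝ => s ^ β / β) (β * s ^ (β - 1) / β) s :=
    (Real.hasDerivAt_rpow_const (Or.inl hs)).div_const β
  rw [h.deriv]
  field_simp

/-- `s ↦ −1/s` is `C¹` on `]½,∞[`. -/
theorem contDiffOn_neg_inv : ContDiffOn ℝ 1 (fun s : ℝ => -s⁻¹) (Ioi (1 / 2)) := by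
  intro s hs
  have hs0 : s ≠ 0 := by simp only [mem_Ioi] at hs; exact (by linarith : (0:ℝ) < s).ne'
  exact (contDiffAt_inv ℝ hs0).neg.contDiffWithinAt

/-- `(−1/s)′ = 1/s²` for `s ≠ 0`. -/
theorem deriv_neg_inv {s : ℝ} (hs : s ≠ 0) : deriv (fun s : ℝ => -s⁻¹) s = (s ^ 2)⁻¹ := by
  have h : HasDerivAt (fun s : ℝ => -s⁻¹) (-(-(s ^ 2)⁻¹)) s := (hasDerivAt_inv hs).neg
  rw [h.deriv, neg_neg]

/-! ### Power Caccioppoli -/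

/-- **POWER CACCIOPPOLI** (Moser 1961 (4.4)): for a `C¹` weak solution `u ≥ 1` of `div(a∇u) = 0`, `β ≠ 0` and `χ ∈ C¹_c`:
`∫ χ² u^{β−1} Du·aDu ≤ (4/β²) ∫ u^{β+1} Dχ·aDχ`. -/
theorem caccioppoli_rpow (hsymm : ∀ y, (a y).IsSymm) (hlam : 0 < lam)
    (hmeas : ∀ i j, Measurable fun y => a y i j)
    (hell : ∀ y (ξ : Fin n → ℝ), lam * (ξ ⬝ᵥ ξ) ≤ ξ ⬝ᵥ (a y *ᵥ ξ)) (hbd : ∀ y i j, |a y i j| ≤ Λ)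
    (hu : ContDiff ℝ 1 u) (hu1 : ∀ y, 1 ≤ u y)
    (hweak : ∀ η : EuclideanSpace ℝ (Fin n) → ℝ, ContDiff ℝ 1 η → HasCompactSupport η →
      ∫ y, ∑ i, ∑ j, a y i j * fderiv ℝ u y (EuclideanSpace.single i 1) *
        fderiv ℝ η y (EuclideanSpace.single j 1) = 0)
    {β : ℝ} (hβ : β ≠ 0) {χ : EuclideanSpace ℝ (Fin n) → ℝ} (hχ : ContDiff ℝ 1 χ) (hχc : HasCompactSupport χ) :
    ∫ y, χ y ^ 2 * u y ^ (β - 1) *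
        ((fun i => fderiv ℝ u y (EuclideanSpace.single i 1)) ⬝ᵥ
          (a y *ᵥ fun i => fderiv ℝ u y (EuclideanSpace.single i 1))) ≤
      4 / β ^ 2 * ∫ y, u y ^ (β + 1) *
        ((fun j => fderiv ℝ χ y (EuclideanSpace.single j 1)) ⬝ᵥ
          (a y *ᵥ fun j => fderiv ℝ χ y (EuclideanSpace.single j 1))) := by
  have hupos : ∀ y, 0 < u y := fun y => lt_of_lt_of_le one_pos (hu1 y)
  have hg' : ∀ s : ℝ, 1 / 2 < s → 0 < deriv (fun s : ℝ => s ^ β / β) s := by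
    intro s hs
    have hs0 : (0 : ℝ) < s := by linarith
    rw [deriv_rpow_div hβ hs0.ne']
    exact Real.rpow_pos_of_pos hs0 _
  have h := caccioppoli_weighted hsymm hlam hmeas hell hbd hu hu1 hweak (contDiffOn_rpow_div β) hg' hχ hχc
  -- rewrite the weights: `g′(u) = u^{β−1}`, `g(u)²/g′(u) = u^{β+1}/β²`
  have h1 : ∀ y, deriv (fun s : ℝ => s ^ β / β) (u y) = u y ^ (β - 1) := fun y => deriv_rpow_div hβ (hupos y).ne'
  have h2 : ∀ y, (u y ^ β / β) ^ 2 / u y ^ (β - 1) = (1 / β ^ 2) * u y ^ (β + 1) := by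
    intro y
    have hy := hupos y
    have hr : (u y ^ β) ^ 2 = u y ^ (β + 1) * u y ^ (β - 1) := by
      rw [← Real.rpow_add hy, sq, ← Real.rpow_add hy]; congr 1; ring
    have hne : u y ^ (β - 1) ≠ 0 := (Real.rpow_pos_of_pos hy _).ne'
    rw [div_pow, hr]
    field_simp
  simp_rw [h1, h2] at h
  calc ∫ y, χ y ^ 2 * u y ^ (β - 1) *
          ((fun i => fderiv ℝ u y (EuclideanSpace.single i 1)) ⬝ᵥ
            (a y *ᵥ fun i => fderiv ℝ u y (EuclideanSpace.single i 1)))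
      ≤ 4 * ∫ y, 1 / β ^ 2 * u y ^ (β + 1) *
          ((fun j => fderiv ℝ χ y (EuclideanSpace.single j 1)) ⬝ᵥ
            (a y *ᵥ fun j => fderiv ℝ χ y (EuclideanSpace.single j 1))) := h
    _ = 4 / β ^ 2 * ∫ y, u y ^ (β + 1) *
          ((fun j => fderiv ℝ χ y (EuclideanSpace.single j 1)) ⬝ᵥ
            (a y *ᵥ fun j => fderiv ℝ χ y (EuclideanSpace.single j 1))) := by
        rw [← integral_const_mul, ← integral_const_mul]
        congr 1; funext y; ring

/-! ### Logarithmic Caccioppoli -/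

/-- **LOGARITHMIC CACCIOPPOLI** (Moser 1961 §5): for a `C¹` weak solution `u ≥ 1` and `χ ∈ C¹_c`:
`∫ χ² u^{−2} Du·aDu ≤ 4 ∫ Dχ·aDχ` (note `u^{−2} Du·aDu = D(log u)·aD(log u)`). -/
theorem caccioppoli_log (hsymm : ∀ y, (a y).IsSymm) (hlam : 0 < lam)
    (hmeas : ∀ i j, Measurable fun y => a y i j)
    (hell : ∀ y (ξ : Fin n → ℝ), lam * (ξ ⬝ᵥ ξ) ≤ ξ ⬝ᵥ (a y *ᵥ ξ)) (hbd : ∀ y i j, |a y i j| ≤ Λ)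
    (hu : ContDiff ℝ 1 u) (hu1 : ∀ y, 1 ≤ u y)
    (hweak : ∀ η : EuclideanSpace ℝ (Fin n) → ℝ, ContDiff ℝ 1 η → HasCompactSupport η →
      ∫ y, ∑ i, ∑ j, a y i j * fderiv ℝ u y (EuclideanSpace.single i 1) *
        fderiv ℝ η y (EuclideanSpace.single j 1) = 0)
    {χ : EuclideanSpace ℝ (Fin n) → ℝ} (hχ : ContDiff ℝ 1 χ) (hχc : HasCompactSupport χ) :
    ∫ y, χ y ^ 2 * (u y ^ 2)⁻¹ *
        ((fun i => fderiv ℝ u y (EuclideanSpace.single i 1)) ⬝ᵥ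
          (a y *ᵥ fun i => fderiv ℝ u y (EuclideanSpace.single i 1))) ≤
      4 * ∫ y, ((fun j => fderiv ℝ χ y (EuclideanSpace.single j 1)) ⬝ᵥ
          (a y *ᵥ fun j => fderiv ℝ χ y (EuclideanSpace.single j 1))) := by
  have hupos : ∀ y, 0 < u y := fun y => lt_of_lt_of_le one_pos (hu1 y)
  have hg' : ∀ s : ℝ, 1 / 2 < s → 0 < deriv (fun s : ℝ => -s⁻¹) s := by
    intro s hs
    have hs0 : (0 : ℝ) < s := by linarith
    rw [deriv_neg_inv hs0.ne']
    positivity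
  have h := caccioppoli_weighted hsymm hlam hmeas hell hbd hu hu1 hweak contDiffOn_neg_inv hg' hχ hχc
  have h1 : ∀ y, deriv (fun s : ℝ => -s⁻¹) (u y) = (u y ^ 2)⁻¹ := fun y => deriv_neg_inv (hupos y).ne'
  have h2 : ∀ y, (-(u y)⁻¹) ^ 2 / (u y ^ 2)⁻¹ = 1 := by
    intro y
    have hy := (hupos y).ne'
    field_simp
  simp_rw [h1, h2, one_mul] at h
  exact h

/-! ### Gradient-norm forms (ellipticity in, coefficient form out) -/

/-- `λ Σᵢ (∂ᵢu)² ≤ Du·aDu` and `Dχ·aDχ ≤ nΛ ‖Dχ‖²` turn the logarithmic Caccioppoli inequality into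
**`λ ∫ χ² ‖D u‖²/u² ≤ 4 n Λ ∫ ‖Dχ‖²`** — the `BMO` input of M2 (`‖D u‖/u = ‖D log u‖`). -/
theorem gradLog_estimate (hsymm : ∀ y, (a y).IsSymm) (hlam : 0 < lam)
    (hmeas : ∀ i j, Measurable fun y => a y i j)
    (hell : ∀ y (ξ : Fin n → ℝ), lam * (ξ ⬝ᵥ ξ) ≤ ξ ⬝ᵥ (a y *ᵥ ξ)) (hbd : ∀ y i j, |a y i j| ≤ Λ)
    (hu : ContDiff ℝ 1 u) (hu1 : ∀ y, 1 ≤ u y)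
    (hweak : ∀ η : EuclideanSpace ℝ (Fin n) → ℝ, ContDiff ℝ 1 η → HasCompactSupport η →
      ∫ y, ∑ i, ∑ j, a y i j * fderiv ℝ u y (EuclideanSpace.single i 1) *
        fderiv ℝ η y (EuclideanSpace.single j 1) = 0)
    {χ : EuclideanSpace ℝ (Fin n) → ℝ} (hχ : ContDiff ℝ 1 χ) (hχc : HasCompactSupport χ) :
    lam * ∫ y, χ y ^ 2 * (u y ^ 2)⁻¹ * ‖fderiv ℝ u y‖ ^ 2 ≤
      4 * (n * Λ) * ∫ y, ‖fderiv ℝ χ y‖ ^ 2 := by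
  have hupos : ∀ y, 0 < u y := fun y => lt_of_lt_of_le one_pos (hu1 y)
  have h := caccioppoli_log hsymm hlam hmeas hell hbd hu hu1 hweak hχ hχc
  have hcu := continuous_fderiv_single hu
  have hcχ := continuous_fderiv_single hχ
  -- continuity of the two norm integrands, compact support
  have hnu : Continuous fun y => ‖fderiv ℝ u y‖ ^ 2 := ((hu.continuous_fderiv one_ne_zero).norm).pow 2
  have hnχ : Continuous fun y => ‖fderiv ℝ χ y‖ ^ 2 := ((hχ.continuous_fderiv one_ne_zero).norm).pow 2
  have hinvu : Continuous fun y => (u y ^ 2)⁻¹ :=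
    ((hu.continuous.pow 2).inv₀ fun y => (pow_pos (hupos y) 2).ne')
  have hIl : Integrable fun y => χ y ^ 2 * (u y ^ 2)⁻¹ * ‖fderiv ℝ u y‖ ^ 2 := by
    have hc : Continuous fun y => χ y ^ 2 * (u y ^ 2)⁻¹ * ‖fderiv ℝ u y‖ ^ 2 :=
      ((hχ.continuous.pow 2).mul hinvu).mul hnu
    refine hc.integrable_of_hasCompactSupport ?_
    exact ((hasCompactSupport_testFun (u := u) (g := fun s => (s ^ 2)⁻¹) hχc).mul_right)
  have hIr : Integrable fun y => ‖fderiv ℝ χ y‖ ^ 2 := by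
    refine hnχ.integrable_of_hasCompactSupport ?_
    exact (hχc.fderiv (𝕜 := ℝ)).norm.comp_left (g := fun s : ℝ => s ^ 2) (by simp)
  -- lower bound on the left integrand, upper bound on the right integrand
  have hle_l : ∀ y, lam * (χ y ^ 2 * (u y ^ 2)⁻¹ * ‖fderiv ℝ u y‖ ^ 2) ≤
      χ y ^ 2 * (u y ^ 2)⁻¹ *
        ((fun i => fderiv ℝ u y (EuclideanSpace.single i 1)) ⬝ᵥ
          (a y *ᵥ fun i => fderiv ℝ u y (EuclideanSpace.single i 1))) := by
    intro y
    have hq := quadForm_lower hell y (fun i => fderiv ℝ u y (EuclideanSpace.single i 1))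
    rw [sum_fderiv_single_sq] at hq
    have hw : 0 ≤ χ y ^ 2 * (u y ^ 2)⁻¹ := by positivity
    nlinarith
  have hle_r : ∀ y, ((fun j => fderiv ℝ χ y (EuclideanSpace.single j 1)) ⬝ᵥ
          (a y *ᵥ fun j => fderiv ℝ χ y (EuclideanSpace.single j 1))) ≤ n * Λ * ‖fderiv ℝ χ y‖ ^ 2 := by
    intro y
    have hq := quadForm_upper hbd y (fun j => fderiv ℝ χ y (EuclideanSpace.single j 1))
    rwa [sum_fderiv_single_sq] at hq
  -- integrability of the coefficient-form integrands (from the Caccioppoli file's lemmas)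
  have hIql : Integrable fun y => χ y ^ 2 * (u y ^ 2)⁻¹ *
      ((fun i => fderiv ℝ u y (EuclideanSpace.single i 1)) ⬝ᵥ
        (a y *ᵥ fun i => fderiv ℝ u y (EuclideanSpace.single i 1))) := by
    have h' := integrable_mul_of_le_continuous (n := n)
      (m := fun y => (fun i => fderiv ℝ u y (EuclideanSpace.single i 1)) ⬝ᵥ
        (a y *ᵥ fun i => fderiv ℝ u y (EuclideanSpace.single i 1)))
      (M := fun y => n * Λ * (∑ i, fderiv ℝ u y (EuclideanSpace.single i 1) ^ 2 +
        ∑ j, fderiv ℝ u y (EuclideanSpace.single j 1) ^ 2) / 2)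
      (φ := fun y => χ y ^ 2 * (u y ^ 2)⁻¹)
      (measurable_dotProduct_mulVec hmeas hcu hcu) (by fun_prop)
      (fun y => abs_dotProduct_mulVec_le hsymm hlam hell hbd y _ _) ((hχ.continuous.pow 2).mul hinvu)
      (hasCompactSupport_testFun (u := u) (g := fun s => (s ^ 2)⁻¹) hχc)
    exact h'.congr (Eventually.of_forall fun y => by ring)
  have hIqr : Integrable fun y => ((fun j => fderiv ℝ χ y (EuclideanSpace.single j 1)) ⬝ᵥ
      (a y *ᵥ fun j => fderiv ℝ χ y (EuclideanSpace.single j 1))) := by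
    refine (hIr.const_mul (n * Λ)).mono' (measurable_dotProduct_mulVec hmeas hcχ hcχ).aestronglyMeasurable
      (Eventually.of_forall fun y => ?_)
    have hq0 : 0 ≤ ((fun j => fderiv ℝ χ y (EuclideanSpace.single j 1)) ⬝ᵥ
        (a y *ᵥ fun j => fderiv ℝ χ y (EuclideanSpace.single j 1))) :=
      (mul_nonneg hlam.le (Finset.sum_nonneg fun i _ => sq_nonneg _)).trans (quadForm_lower hell y _)
    rw [Real.norm_eq_abs, abs_of_nonneg hq0]
    exact hle_r y
  calc lam * ∫ y, χ y ^ 2 * (u y ^ 2)⁻¹ * ‖fderiv ℝ u y‖ ^ 2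
      = ∫ y, lam * (χ y ^ 2 * (u y ^ 2)⁻¹ * ‖fderiv ℝ u y‖ ^ 2) := (integral_const_mul _ _).symm
    _ ≤ ∫ y, χ y ^ 2 * (u y ^ 2)⁻¹ *
          ((fun i => fderiv ℝ u y (EuclideanSpace.single i 1)) ⬝ᵥ
            (a y *ᵥ fun i => fderiv ℝ u y (EuclideanSpace.single i 1))) :=
        integral_mono (hIl.const_mul lam) hIql hle_l
    _ ≤ 4 * ∫ y, ((fun j => fderiv ℝ χ y (EuclideanSpace.single j 1)) ⬝ᵥ
          (a y *ᵥ fun j => fderiv ℝ χ y (EuclideanSpace.single j 1))) := h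
    _ ≤ 4 * ∫ y, n * Λ * ‖fderiv ℝ χ y‖ ^ 2 :=
        mul_le_mul_of_nonneg_left (integral_mono hIqr (hIr.const_mul _) hle_r) (by norm_num)
    _ = 4 * (n * Λ) * ∫ y, ‖fderiv ℝ χ y‖ ^ 2 := by rw [integral_const_mul]; ring

end Summit.NavierStokesRegularity.NavierStokesRegularity.Theorems.PoloidalWindowDoorPoloidalWindowRigidityDivFormCaccioppoliPowers

end
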